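import Literature.NumberTheory.EllipticCurves.IsogenyFormulaReduction
import HarnessLib

/-!
# The isogeny over `𝔽_p` attached to an isogeny formula with good reduction at a place (AEC III.4.8)

Topic `NumberTheory/EllipticCurves` (trunk T-ELLARITH, notion `cm_endomorphisms_isogeny`).
Sibling of `Literature.NumberTheory.EllipticCurves.IsogenyFromRationalMap` (the isogeny
`IsogenyFormula.toIsogeny` attached to an explicit formula over a field of characteristic `0`)
and `Literature.NumberTheory.EllipticCurves.IsogenyFormulaReduction` (additivity of a reduced
formula over the residue field of a valuation ring, by lifting). For an isogeny formula
`Φ : W₁ → W₂` with coefficients in a ring `R₀` (in the applications `ℤ`, or `ℤ[√d]` for the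
complex multiplications), a ring map `f₀ : R₀ → 𝔽_p` under which `W₁, W₂` stay elliptic and
the leading coefficients of `U, h` survive, and a **place above `p`** compatible with `f₀` — a
valuation subring `A` of an algebraically closed field `K` of characteristic `0`, a ring map
`f_A : R₀ → A` (good reduction, unit leading coefficients) and a ring map
`g : 𝔽̄_p → k_A` to the residue field with `g ∘ f₀ = (reduction) ∘ f_A` (in the applications `g`
is an isomorphism `AlgebraicClosure (ZMod p) ≅ k_A`, `Literature.RingTheory.Valuation.AlgClosedResidue`)
— this file produces

* `WeierstrassCurve.IsogenyFormula.toIsogenyOfPlace` — an isogeny `W₁ ⊗ 𝔽_p → W₂ ⊗ 𝔽_p` over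
  `𝔽_p` (the prelude structure `WeierstrassCurve.Isogeny` over `ZMod p`), which on the
  `𝔽̄_p`-points `(x, y)` with `h̄(x) ≠ 0` is `(Ū(x)/h̄(x)², (S̄(x) y + T̄(x))/h̄(x)³)`
  (`toIsogenyOfPlace_some`);

i.e. Silverman's Thm. III.4.8 ("a rational map between elliptic curves sending `O` to `O` is a
homomorphism") for the reduced formula, together with Galois descent to `𝔽_p` and finiteness of
the kernel, exactly as `toIsogeny` does in characteristic `0`. The one input that is not
characteristic-free in `IsogenyFromRationalMap` — additivity off the exceptional set — is
supplied by reduction modulo the place (`IsogenyFormula.pointFun_add_residue` for the formula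
over `A`, transported along `g`): `red₀_geom_pointFun_add`. The remaining steps (`extend`, algebraicity, `Γ`-equivariance) are the
characteristic-free ones of `IsogenyFromRationalMap`, repeated for the new homomorphism.

Consumer: the reduction modulo `p` of the complex multiplications of the CM curves over `ℚ`
(`ComplexMultiplicationDeuringReductionProofs`, Deuring's theorem).

## References

* [SilvermanAEC2009] J. H. Silverman, *The Arithmetic of Elliptic Curves*, 2nd ed., GTM 106
  (2009): Thm. III.4.8 (PDF pp. 70–71), Remark III.4.13.3, Prop. VII.2.1.
* [SilvermanAdvancedTopics1994] J. H. Silverman, *Advanced Topics in the Arithmetic of Elliptic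
  Curves*, GTM 151 (1994): Prop. II.4.4 (reduction of isogenies).

## Design

Theorems and definitions-with-body (`red₀`, `atPlace`, `redAtPlace`, `geomHomOfPlace`,
`toIsogenyOfPlace`); `noncomputable section`, `open scoped Classical`; dot-notation extensions
in `namespace WeierstrassCurve.IsogenyFormula`, as in `IsogenyFromRationalMap`.
-/

noncomputable section

open scoped Classical

open Polynomial IsLocalRing

universe u

namespace WeierstrassCurve

namespace IsogenyFormula

variable {R₀ : Type} [CommRing R₀] {W₁ W₂ : WeierstrassCurve R₀} (Φ : IsogenyFormula W₁ W₂)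
  (p : ℕ) [Fact p.Prime] (f₀ : R₀ →+* ZMod p)
  (hU₀ : f₀ Φ.U.leadingCoeff ≠ 0) (hh₀ : f₀ Φ.h.leadingCoeff ≠ 0)

/-! ## The formula over `𝔽_p` -/

/-- **The formula read over `𝔽_p` along `f₀`** (leading coefficients of `U`, `h` survive).
[folklore] -/
def red₀ : IsogenyFormula (W₁.map f₀) (W₂.map f₀) :=
  Φ.mapOfLeadingCoeff f₀ hU₀ hh₀

/-! ## Additivity off the exceptional set, by reduction modulo a compatible place -/

section Place

variable {K : Type u} [Field K] (A : ValuationSubring K)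
  (fA : R₀ →+* A) (hUA : IsUnit (fA Φ.U.leadingCoeff)) (hhA : IsUnit (fA Φ.h.leadingCoeff))
  (g : AlgebraicClosure (ZMod p) →+* ResidueField A)
  (hg : (g.comp (algebraMap (ZMod p) (AlgebraicClosure (ZMod p)))).comp f₀ = (residue A).comp fA)

/-- The formula over the valuation ring `A` of the place. [folklore] -/
def atPlace : IsogenyFormula (W₁.map fA) (W₂.map fA) :=
  Φ.mapOfLeadingCoeff fA hUA.ne_zero hhA.ne_zero

/-- Its `U` has unit leading coefficient. [folklore] -/
theorem isUnit_leadingCoeff_atPlace_U : IsUnit (Φ.atPlace A fA hUA hhA).U.leadingCoeff := by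
  change IsUnit (Φ.U.map fA).leadingCoeff
  rwa [leadingCoeff_map_of_leadingCoeff_ne_zero fA hUA.ne_zero]

/-- Its `h` has unit leading coefficient. [folklore] -/
theorem isUnit_leadingCoeff_atPlace_h : IsUnit (Φ.atPlace A fA hUA hhA).h.leadingCoeff := by
  change IsUnit (Φ.h.map fA).leadingCoeff
  rwa [leadingCoeff_map_of_leadingCoeff_ne_zero fA hhA.ne_zero]

include hg in
/-- The reduction of `W ⊗ 𝔽̄_p` along `g` is the reduction of the model over `A`. [folklore] -/
theorem baseChange_map_eq_of_place (W : WeierstrassCurve R₀) :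
    ((W.map f₀).baseChange (AlgebraicClosure (ZMod p))).map g = (W.map fA).map (residue A) := by
  rw [baseChange, map_map, map_map, map_map, hg]

include hg in
/-- Polynomial data read over `𝔽̄_p` and pushed along `g` agree with the data reduced from `A`.
[folklore] -/
theorem map_map_map_eq_of_place (q : R₀[X]) :
    ((q.map f₀).map (algebraMap (ZMod p) (AlgebraicClosure (ZMod p)))).map g =
      (q.map fA).map (residue A) := by
  rw [Polynomial.map_map, Polynomial.map_map, Polynomial.map_map, hg]

/-- The formula reduced from `A` to the residue field. [folklore] -/
abbrev redAtPlace : IsogenyFormula ((W₁.map fA).map (residue A)) ((W₂.map fA).map (residue A)) :=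
  (Φ.atPlace A fA hUA hhA).red A (Φ.isUnit_leadingCoeff_atPlace_U A fA hUA hhA)
    (Φ.isUnit_leadingCoeff_atPlace_h A fA hUA hhA)

include hg in
/-- Data comparison: `h`. [folklore] -/
theorem redAtPlace_h : (Φ.redAtPlace A fA hUA hhA).h = (Φ.red₀ p f₀ hU₀ hh₀).geom.h.map g := by
  change (Φ.h.map fA).map (residue A) = ((Φ.h.map f₀).map _).map g
  rw [map_map_map_eq_of_place p f₀ A fA g hg]

include hg in
/-- Data comparison: `U`. [folklore] -/
theorem redAtPlace_U : (Φ.redAtPlace A fA hUA hhA).U = (Φ.red₀ p f₀ hU₀ hh₀).geom.U.map g := by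
  change (Φ.U.map fA).map (residue A) = ((Φ.U.map f₀).map _).map g
  rw [map_map_map_eq_of_place p f₀ A fA g hg]

include hg in
/-- Data comparison: `S`. [folklore] -/
theorem redAtPlace_S : (Φ.redAtPlace A fA hUA hhA).S = (Φ.red₀ p f₀ hU₀ hh₀).geom.S.map g := by
  change (Φ.S.map fA).map (residue A) = ((Φ.S.map f₀).map _).map g
  rw [map_map_map_eq_of_place p f₀ A fA g hg]

include hg in
/-- Data comparison: `T`. [folklore] -/
theorem redAtPlace_T : (Φ.redAtPlace A fA hUA hhA).T = (Φ.red₀ p f₀ hU₀ hh₀).geom.T.map g := by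
  change (Φ.T.map fA).map (residue A) = ((Φ.T.map f₀).map _).map g
  rw [map_map_map_eq_of_place p f₀ A fA g hg]

variable [(W₁.map f₀).IsElliptic] [(W₂.map f₀).IsElliptic] [(W₁.map fA).IsElliptic]
  [(W₂.map fA).IsElliptic]

omit [(W₁.map f₀).IsElliptic] [(W₁.map fA).IsElliptic] in
include hg in
/-- **The point map over `𝔽̄_p` pushed along `g` is the point map of the formula reduced from
`A`** (all points, exceptional ones included). [folklore] -/
theorem mapPoint_red₀_geom_pointFun (P : (W₁.map f₀).geomPoints) :
    mapPoint g (baseChange_map_eq_of_place p f₀ A fA g hg W₂) ((Φ.red₀ p f₀ hU₀ hh₀).geom.pointFun P) =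
      (Φ.redAtPlace A fA hUA hhA).pointFun (mapPoint g (baseChange_map_eq_of_place p f₀ A fA g hg W₁) P) :=
  mapPoint_pointFun g _ _ _ _ (Φ.redAtPlace_h p f₀ hU₀ hh₀ A fA hUA hhA g hg)
    (Φ.redAtPlace_U p f₀ hU₀ hh₀ A fA hUA hhA g hg) (Φ.redAtPlace_S p f₀ hU₀ hh₀ A fA hUA hhA g hg)
    (Φ.redAtPlace_T p f₀ hU₀ hh₀ A fA hUA hhA g hg) P

omit [(W₁.map f₀).IsElliptic] [(W₂.map f₀).IsElliptic] [(W₁.map fA).IsElliptic]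
  [(W₂.map fA).IsElliptic] in
include hg in
/-- The exceptional sets correspond under `g`. [folklore] -/
theorem mapPoint_mem_redAtPlace_bad_iff (P : (W₁.map f₀).geomPoints) :
    mapPoint g (baseChange_map_eq_of_place p f₀ A fA g hg W₁) P ∈ (Φ.redAtPlace A fA hUA hhA).bad ↔
      P ∈ (Φ.red₀ p f₀ hU₀ hh₀).geom.bad :=
  mapPoint_mem_bad_iff g _ _ _ (Φ.redAtPlace_h p f₀ hU₀ hh₀ A fA hUA hhA g hg) P

variable [IsAlgClosed K] [CharZero K]

omit [(W₁.map f₀).IsElliptic] in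
include hUA hhA hg in
/-- **Additivity of the formula on `𝔽̄_p`-points off the exceptional set.** Transport the points
along `g` to the residue field of the place, where the reduced formula is additive off its
exceptional set (`pointFun_add_residue`: lift to `K`, add in characteristic `0`, reduce), and come
back (`mapPoint_pointFun`, `mapPoint` is injective). Silverman, *AEC*, Thm. III.4.8 with
Prop. VII.2.1. [cite: SilvermanAEC2009, Thm. III.4.8 and Prop. VII.2.1] -/
theorem red₀_geom_pointFun_add :
    ∀ P Q : (W₁.map f₀).geomPoints,
      P ∉ (Φ.red₀ p f₀ hU₀ hh₀).geom.bad → Q ∉ (Φ.red₀ p f₀ hU₀ hh₀).geom.bad →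
        P + Q ∉ (Φ.red₀ p f₀ hU₀ hh₀).geom.bad →
          (Φ.red₀ p f₀ hU₀ hh₀).geom.pointFun (P + Q) =
            (Φ.red₀ p f₀ hU₀ hh₀).geom.pointFun P + (Φ.red₀ p f₀ hU₀ hh₀).geom.pointFun Q := by
  intro P Q hP hQ hPQ
  have h₁ := baseChange_map_eq_of_place p f₀ A fA g hg W₁
  have h₂ := baseChange_map_eq_of_place p f₀ A fA g hg W₂
  have key := (Φ.atPlace A fA hUA hhA).pointFun_add_residue A
    (Φ.isUnit_leadingCoeff_atPlace_U A fA hUA hhA) (Φ.isUnit_leadingCoeff_atPlace_h A fA hUA hhA)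
    (mapPoint g h₁ P) (mapPoint g h₁ Q)
    (by rwa [Φ.mapPoint_mem_redAtPlace_bad_iff p f₀ hU₀ hh₀ A fA hUA hhA g hg])
    (by rwa [Φ.mapPoint_mem_redAtPlace_bad_iff p f₀ hU₀ hh₀ A fA hUA hhA g hg])
    (by rwa [← map_add, Φ.mapPoint_mem_redAtPlace_bad_iff p f₀ hU₀ hh₀ A fA hUA hhA g hg])
  change (Φ.redAtPlace A fA hUA hhA).pointFun (mapPoint g h₁ P + mapPoint g h₁ Q) =
    (Φ.redAtPlace A fA hUA hhA).pointFun (mapPoint g h₁ P) +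
      (Φ.redAtPlace A fA hUA hhA).pointFun (mapPoint g h₁ Q) at key
  rw [← map_add, ← Φ.mapPoint_red₀_geom_pointFun p f₀ hU₀ hh₀ A fA hUA hhA g hg,
    ← Φ.mapPoint_red₀_geom_pointFun p f₀ hU₀ hh₀ A fA hUA hhA g hg,
    ← Φ.mapPoint_red₀_geom_pointFun p f₀ hU₀ hh₀ A fA hUA hhA g hg, ← map_add] at key
  exact mapPoint_injective g h₂ key

/-! ## The isogeny over `𝔽_p` -/

/-- **The homomorphism on `𝔽̄_p`-points** attached to the formula: the unique homomorphism
agreeing with the formula off the (finite) exceptional set. [folklore] -/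
def geomHomOfPlace : (W₁.map f₀).geomPoints →+ (W₂.map f₀).geomPoints :=
  Literature.NumberTheory.EllipticCurves.RationalMapHom.extend (Φ.red₀ p f₀ hU₀ hh₀).geom.finite_bad
    (Φ.red₀ p f₀ hU₀ hh₀).geomFun (Φ.red₀_geom_pointFun_add p f₀ hU₀ hh₀ A fA hUA hhA g hg)

/-- Off the exceptional set the homomorphism is the formula. [folklore] -/
theorem geomHomOfPlace_apply_of_not_mem {P : (W₁.map f₀).geomPoints}
    (hP : P ∉ (Φ.red₀ p f₀ hU₀ hh₀).geom.bad) :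
    Φ.geomHomOfPlace p f₀ hU₀ hh₀ A fA hUA hhA g hg P = (Φ.red₀ p f₀ hU₀ hh₀).geom.pointFun P :=
  Literature.NumberTheory.EllipticCurves.RationalMapHom.extend_apply_of_not_mem _ _ _ hP

/-- The value at a good affine point. [folklore] -/
theorem geomHomOfPlace_some {x y : AlgebraicClosure (ZMod p)}
    (hxy : ((W₁.map f₀).baseChange (AlgebraicClosure (ZMod p))).toAffine.Nonsingular x y)
    (hx : (Φ.red₀ p f₀ hU₀ hh₀).geom.h.eval x ≠ 0) :
    Φ.geomHomOfPlace p f₀ hU₀ hh₀ A fA hUA hhA g hg (.some _ _ hxy) =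
      .some _ _ ((Φ.red₀ p f₀ hU₀ hh₀).geom.nonsingular_val hxy.1 hx) := by
  rw [Φ.geomHomOfPlace_apply_of_not_mem p f₀ hU₀ hh₀ A fA hUA hhA g hg
    (fun h => hx (((Φ.red₀ p f₀ hU₀ hh₀).geom.some_mem_bad_iff hxy).mp h))]
  exact (Φ.red₀ p f₀ hU₀ hh₀).geom.pointFun_some hxy hx

/-- The homomorphism is given by the rational map `(Ū/h̄², (S̄ y + T̄)/h̄³)` off the exceptional
set (as in `IsogenyFormula.isAlgebraicOn_geomHom`). [folklore] -/
theorem isAlgebraicOn_geomHomOfPlace :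
    IsAlgebraicOn _ _ (Φ.geomHomOfPlace p f₀ hU₀ hh₀ A fA hUA hhA g hg) := by
  set ψ := (Φ.red₀ p f₀ hU₀ hh₀).geom with hψ
  refine ⟨Polynomial.aeval (MvPolynomial.X 0) ψ.U, Polynomial.aeval (MvPolynomial.X 0) (ψ.h ^ 2),
    Polynomial.aeval (MvPolynomial.X 0) ψ.S * MvPolynomial.X 1 +
      Polynomial.aeval (MvPolynomial.X 0) ψ.T,
    Polynomial.aeval (MvPolynomial.X 0) (ψ.h ^ 3), ψ.finite_bad.subset ?_⟩
  intro P hP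
  by_contra hPb
  apply hP
  obtain ⟨x, y, hxy, rfl, hx⟩ := ψ.exists_of_not_mem_bad hPb
  refine ⟨x, y, hxy, rfl, ?_, ?_, ?_⟩
  · rw [eval_aeval_X_zero]; simpa using pow_ne_zero 2 hx
  · rw [eval_aeval_X_zero]; simpa using pow_ne_zero 3 hx
  · have h1 : MvPolynomial.eval ![x, y] (Polynomial.aeval (MvPolynomial.X 0) ψ.U) /
        MvPolynomial.eval ![x, y] (Polynomial.aeval (MvPolynomial.X 0) (ψ.h ^ 2)) =
        ψ.valX x := by
      rw [eval_aeval_X_zero, eval_aeval_X_zero, eval_pow]; rfl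
    have h2 : MvPolynomial.eval ![x, y] (Polynomial.aeval (MvPolynomial.X 0) ψ.S *
        MvPolynomial.X 1 + Polynomial.aeval (MvPolynomial.X 0) ψ.T) /
        MvPolynomial.eval ![x, y] (Polynomial.aeval (MvPolynomial.X 0) (ψ.h ^ 3)) =
        ψ.valY x y := by
      rw [map_add, map_mul, eval_aeval_X_zero, eval_aeval_X_zero, eval_aeval_X_zero,
        MvPolynomial.eval_X, eval_pow]; rfl
    refine ⟨by rw [h1, h2]; exact ψ.nonsingular_val hxy.1 hx, ?_⟩
    rw [Φ.geomHomOfPlace_some p f₀ hU₀ hh₀ A fA hUA hhA g hg hxy hx]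
    congr 1 <;> simp only [h1, h2] <;> rfl

/-- **The homomorphism is defined over `𝔽_p`**: it commutes with `Γ_{𝔽_p}` (both `P ↦ φ(σP)`
and `P ↦ σ φ(P)` are homomorphisms agreeing with the equivariant formula off the finite
exceptional set, `IsogenyFormula.geomFun_smul`). [folklore] -/
theorem geomHomOfPlace_smul (σ : Field.absoluteGaloisGroup (ZMod p)) (P : (W₁.map f₀).geomPoints) :
    Φ.geomHomOfPlace p f₀ hU₀ hh₀ A fA hUA hhA g hg (σ • P) =
      σ • Φ.geomHomOfPlace p f₀ hU₀ hh₀ A fA hUA hhA g hg P := by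
  set ψ := (Φ.red₀ p f₀ hU₀ hh₀) with hψ
  let g₁ : (W₁.map f₀).geomPoints →+ (W₂.map f₀).geomPoints :=
    (Φ.geomHomOfPlace p f₀ hU₀ hh₀ A fA hUA hhA g hg).comp (DistribSMul.toAddMonoidHom _ σ)
  let g₂ : (W₁.map f₀).geomPoints →+ (W₂.map f₀).geomPoints :=
    (DistribSMul.toAddMonoidHom _ σ).comp (Φ.geomHomOfPlace p f₀ hU₀ hh₀ A fA hUA hhA g hg)
  have : g₁ = g₂ := by
    refine Literature.NumberTheory.EllipticCurves.AddMonoidHom.eq_of_eqOn_compl_finite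
      (G := (W₁.map f₀).geomPoints) (S := (ψ.geom.bad : Set _)) ψ.geom.finite_bad fun Q hQ => ?_
    show Φ.geomHomOfPlace p f₀ hU₀ hh₀ A fA hUA hhA g hg (σ • Q) =
      σ • Φ.geomHomOfPlace p f₀ hU₀ hh₀ A fA hUA hhA g hg Q
    rw [Φ.geomHomOfPlace_apply_of_not_mem p f₀ hU₀ hh₀ A fA hUA hhA g hg hQ,
      Φ.geomHomOfPlace_apply_of_not_mem p f₀ hU₀ hh₀ A fA hUA hhA g hg
        (fun h => hQ ((ψ.smul_mem_bad_iff σ Q).mp h))]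
    exact ψ.geomFun_smul σ Q
  exact congrArg (fun g : _ →+ _ => g P) this

/-- **The isogeny over `𝔽_p` attached to an isogeny formula with good reduction at a place above
`p`** (Silverman, *AEC*, Thm. III.4.8 for the formula over `𝔽_p`: the rational map
`(x, y) ↦ (Ū(x)/h̄(x)², (S̄(x) y + T̄(x))/h̄(x)³)`, `O ↦ O`, between the elliptic curves
`W₁ ⊗ 𝔽_p`, `W₂ ⊗ 𝔽_p` is a homomorphism, defined over `𝔽_p`, with finite kernel). Its additivity
comes by reduction modulo the place from the characteristic-`0` theorem of
`IsogenyFromRationalMap` (`red₀_geom_pointFun_add`); on `𝔽̄_p`-points off `{O} ∪ {h̄(x) = 0}` it is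
the formula (`toIsogenyOfPlace_some`). [cite: SilvermanAEC2009, Thm. III.4.8 (PDF pp. 70–71) and Prop. VII.2.1]
[cite: SilvermanAdvancedTopics1994, Prop. II.4.4] -/
def toIsogenyOfPlace : Isogeny (W₁.map f₀) (W₂.map f₀) where
  toAddMonoidHom := Φ.geomHomOfPlace p f₀ hU₀ hh₀ A fA hUA hhA g hg
  isAlgebraic := Φ.isAlgebraicOn_geomHomOfPlace p f₀ hU₀ hh₀ A fA hUA hhA g hg
  equivariant := Φ.geomHomOfPlace_smul p f₀ hU₀ hh₀ A fA hUA hhA g hg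
  finite_ker := (Φ.isAlgebraicOn_geomHomOfPlace p f₀ hU₀ hh₀ A fA hUA hhA g hg).finite_ker

/-- The isogeny over `𝔽_p` on a geometric point `(x, y)` with `h̄(x) ≠ 0` is
`(Ū(x)/h̄(x)², (S̄(x)y + T̄(x))/h̄(x)³)`. [folklore] -/
theorem toIsogenyOfPlace_some {x y : AlgebraicClosure (ZMod p)}
    (hxy : ((W₁.map f₀).baseChange (AlgebraicClosure (ZMod p))).toAffine.Nonsingular x y)
    (hx : (Φ.red₀ p f₀ hU₀ hh₀).geom.h.eval x ≠ 0) :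
    Φ.toIsogenyOfPlace p f₀ hU₀ hh₀ A fA hUA hhA g hg (.some _ _ hxy) =
      .some _ _ ((Φ.red₀ p f₀ hU₀ hh₀).geom.nonsingular_val hxy.1 hx) :=
  Φ.geomHomOfPlace_some p f₀ hU₀ hh₀ A fA hUA hhA g hg hxy hx

/-- Off the exceptional set the isogeny is the formula's point map. [folklore] -/
theorem toIsogenyOfPlace_apply_of_not_mem {P : (W₁.map f₀).geomPoints}
    (hP : P ∉ (Φ.red₀ p f₀ hU₀ hh₀).geom.bad) :
    Φ.toIsogenyOfPlace p f₀ hU₀ hh₀ A fA hUA hhA g hg P = (Φ.red₀ p f₀ hU₀ hh₀).geom.pointFun P :=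
  Φ.geomHomOfPlace_apply_of_not_mem p f₀ hU₀ hh₀ A fA hUA hhA g hg hP

/-- **The isogeny over `𝔽_p` pushed along `g` is the point map of the formula reduced from `A`**,
at every point off the exceptional set (the comparison used to reduce identities between isogenies
modulo the place). [folklore] -/
theorem mapPoint_toIsogenyOfPlace {P : (W₁.map f₀).geomPoints}
    (hP : P ∉ (Φ.red₀ p f₀ hU₀ hh₀).geom.bad) :
    mapPoint g (baseChange_map_eq_of_place p f₀ A fA g hg W₂)
        (Φ.toIsogenyOfPlace p f₀ hU₀ hh₀ A fA hUA hhA g hg P) =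
      (Φ.redAtPlace A fA hUA hhA).pointFun
        (mapPoint g (baseChange_map_eq_of_place p f₀ A fA g hg W₁) P) := by
  rw [Φ.toIsogenyOfPlace_apply_of_not_mem p f₀ hU₀ hh₀ A fA hUA hhA g hg hP]
  exact Φ.mapPoint_red₀_geom_pointFun p f₀ hU₀ hh₀ A fA hUA hhA g hg P

end Place

end IsogenyFormula

end WeierstrassCurve
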